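/- LEAD seat `ym-line-cbag-p1` (prover-ym-line-cbag-p1-g24-0), route `EguchiKawaiDirectionLadder` (ideator ym-idea-2, LINE 8),
crux K_A `TripleSmallBallMargin` (stmt-QuantumFields-27724), S10-A of the LEAD's assembly contract (STATUS 15:0xZ): width seat w4's
polar/defect split `M = Θ + R + S` (`…PolarDefect`, `…CompressionSplit`) made `N`-UNIFORMLY USABLE: (i) no invertibility hypothesis
(the tree's general polar decomposition `Literature.LinearAlgebra.Matrix.exists_unitary_polar`, Horn–Johnson 7.3.1), (ii) the defect is
written `(H+1)⁻¹ · D` with `‖(H+1)⁻¹‖ ≤ 1`, so the far part satisfies the LINEAR bound `Σ|S|² ≤ ‖D₂‖_F² ≤ tr D₂` as soon as `0 ≤ D₂ ≤ 1`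
(for a compression of a unitary: `tr D₂` = the far off-block Frobenius MASS, not its square).  ROUTE-INDEPENDENT.  Nothing here bears
on the Yang–Mills mass gap (barrier-ledger line onto `EguchiKawaiBreakdown`). -/
import Summits.QuantumFields.YangMills.Theorems.EguchiKawaiDirectionLadderPolarDefect
import Summits.QuantumFields.YangMills.Theorems.EguchiKawaiDirectionLadderRobustPairTransfer
import Literature.LinearAlgebra.Matrix.PolarDecompositionGeneral
import HarnessLib

/-!
# Route `EguchiKawaiDirectionLadder`: unitary + low rank + small, for EVERY square matrix, with the linear trace bound

* `exists_polar_defect_general` — for every `M ∈ M_n(ℂ)`: `M − Θ = −(1 − MM†)·X` with `Θ` unitary, `‖X‖_op ≤ 1`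
  (`M = H Θ`, `H = (MM†)^{1/2}`, `X = (H+1)⁻¹Θ`; no `IsUnit M`).
* `exists_unitary_add_lowRank_add_small_general` — `1 − MM† = D₁ + D₂` ⇒ `M = Θ + R + S`, `rank R ≤ rank D₁`, `Σ|S_{ij}|² ≤ Σ|(D₂)_{ij}|²`.
* `re_trace_mul_nonneg_of_posSemidef`, `sum_norm_sq_le_re_trace_of_posSemidef_le_one` — `0 ≤ D ≤ 1 ⇒ ‖D‖_F² ≤ Re tr D`, the step that makes the
  far part LINEAR in the off-block mass.
-/

set_option autoImplicit false

noncomputable section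

open NormedSpace
open scoped Matrix ComplexOrder MatrixOrder Matrix.Norms.L2Operator

namespace Summit.QuantumFields.YangMills.Theorems.EguchiKawaiDirectionLadder

variable {n : Type} [Fintype n] [DecidableEq n]

/-- **The polar unitary and the defect identity, for every square matrix** (no invertibility): there are a unitary `Θ` and
`X` with `‖X‖_op ≤ 1` such that `M − Θ = −(1 − MM†)·X`.  (`M = HΘ` with `H = (MM†)^{1/2}` by the general polar decomposition;
`H − 1 = (H² − 1)(H + 1)⁻¹`.) -/
theorem exists_polar_defect_general (M : Matrix n n ℂ) :
    ∃ Θ : Matrix n n ℂ, Θ ∈ Matrix.unitaryGroup n ℂ ∧ ∃ X : Matrix n n ℂ, ‖X‖ ≤ 1 ∧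
      M - Θ = -((1 - M * Mᴴ) * X) := by
  letI : CStarAlgebra (Matrix n n ℂ) := {}
  obtain ⟨Θ, hΘ, hMΘ, -⟩ := Literature.LinearAlgebra.Matrix.exists_unitary_polar M
  set H : Matrix n n ℂ := CFC.sqrt (M * Mᴴ) with hHdef
  have hHpsd : H.PosSemidef := Literature.LinearAlgebra.Matrix.posSemidef_sqrt_mul_conjTranspose M
  have hHH : H * H = M * Mᴴ := Literature.LinearAlgebra.Matrix.sqrt_mul_conjTranspose_mul_self M
  have hunit : IsUnit (H + 1) := (Matrix.PosDef.posSemidef_add hHpsd Matrix.PosDef.one).isUnit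
  have hdet : IsUnit (H + 1).det := (Matrix.isUnit_iff_isUnit_det _).mp hunit
  have hfac : H - 1 = (H * H - 1) * (H + 1)⁻¹ := by
    have h2 : (H - 1) * (H + 1) = H * H - 1 := by noncomm_ring
    rw [← h2, mul_assoc, Matrix.mul_nonsing_inv _ hdet, mul_one]
  refine ⟨Θ, hΘ, (H + 1)⁻¹ * Θ, ?_, ?_⟩
  · have : ‖(H + 1)⁻¹ * Θ‖ = ‖(H + 1)⁻¹‖ := CStarRing.norm_mul_coe_unitary (H + 1)⁻¹ ⟨Θ, hΘ⟩
    rw [this]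
    exact norm_inv_add_one_le_one hHpsd
  · calc M - Θ = (H - 1) * Θ := by rw [hMΘ]; noncomm_ring
      _ = (H * H - 1) * (H + 1)⁻¹ * Θ := by rw [hfac]
      _ = -((1 - M * Mᴴ) * ((H + 1)⁻¹ * Θ)) := by rw [hHH]; noncomm_ring

/-- **Unitary + low rank + small, for every square matrix.** If `1 − MM† = D₁ + D₂` then `M = Θ + R + S` with `Θ` unitary,
`rank R ≤ rank D₁` and `Σ|S_{ij}|² ≤ Σ|(D₂)_{ij}|²`. -/
theorem exists_unitary_add_lowRank_add_small_general (M D₁ D₂ : Matrix n n ℂ) (hD : 1 - M * Mᴴ = D₁ + D₂) :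
    ∃ Θ R S : Matrix n n ℂ, Θ ∈ Matrix.unitaryGroup n ℂ ∧ R.rank ≤ D₁.rank ∧
      ∑ i, ∑ j, ‖S i j‖ ^ 2 ≤ ∑ i, ∑ j, ‖D₂ i j‖ ^ 2 ∧ M = Θ + R + S := by
  obtain ⟨Θ, hΘ, X, hX, hMX⟩ := exists_polar_defect_general M
  refine ⟨Θ, -(D₁ * X), -(D₂ * X), hΘ, ?_, ?_, ?_⟩
  · rw [rank_neg]; exact Matrix.rank_mul_le_left _ _
  · have h := sum_norm_sq_mul_le' X D₂
    have hX1 : ‖X‖ ^ 2 ≤ 1 := by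
      have := norm_nonneg X
      nlinarith
    have h0 : 0 ≤ ∑ i, ∑ j, ‖D₂ i j‖ ^ 2 := Finset.sum_nonneg fun _ _ => Finset.sum_nonneg fun _ _ => by positivity
    calc ∑ i, ∑ j, ‖(-(D₂ * X)) i j‖ ^ 2 = ∑ i, ∑ j, ‖(D₂ * X) i j‖ ^ 2 := by simp
      _ ≤ ‖X‖ ^ 2 * ∑ i, ∑ j, ‖D₂ i j‖ ^ 2 := h
      _ ≤ 1 * ∑ i, ∑ j, ‖D₂ i j‖ ^ 2 := by gcongr
      _ = ∑ i, ∑ j, ‖D₂ i j‖ ^ 2 := one_mul _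
  · calc M = Θ + (M - Θ) := by abel
      _ = Θ + -(D₁ * X) + -(D₂ * X) := by rw [hMX, hD]; noncomm_ring

/-! ### The linear trace bound `‖D‖_F² ≤ tr D` for `0 ≤ D ≤ 1` -/

/-- `Re tr (A B) ≥ 0` for positive semidefinite `A`, `B` (write `B = S S`, `S = B^{1/2}` Hermitian, cycle the trace, `S A S† ≥ 0`). -/
theorem re_trace_mul_nonneg_of_posSemidef {A B : Matrix n n ℂ} (hA : A.PosSemidef) (hB : B.PosSemidef) :
    0 ≤ (Matrix.trace (A * B)).re := by
  set S : Matrix n n ℂ := CFC.sqrt B with hSdef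
  have hS : S.PosSemidef := Matrix.nonneg_iff_posSemidef.mp (CFC.sqrt_nonneg B)
  have hSS : S * S = B := CFC.sqrt_mul_sqrt_self B hB.nonneg
  have hSH : Sᴴ = S := hS.1.eq
  have hcyc : Matrix.trace (A * B) = Matrix.trace (S * A * Sᴴ) := by
    rw [← hSS, ← Matrix.mul_assoc, Matrix.trace_mul_cycle, hSH]
  rw [hcyc]
  have h := (hA.mul_mul_conjTranspose_same S).trace_nonneg
  exact (Complex.nonneg_iff.1 h).1

/-- **`0 ≤ D ≤ 1 ⇒ ‖D‖_F² ≤ Re tr D`**: for `D` with `0 ≤ D` and `0 ≤ 1 − D` (Loewner order),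
`Σ|D_{ij}|² = Re tr D² ≤ Re tr D` (`tr D − tr D² = tr(D(1 − D)) ≥ 0`). -/
theorem sum_norm_sq_le_re_trace_of_posSemidef_le_one {D : Matrix n n ℂ} (hD0 : D.PosSemidef)
    (hD1 : (1 - D).PosSemidef) : ∑ i, ∑ j, ‖D i j‖ ^ 2 ≤ (Matrix.trace D).re := by
  rw [sum_norm_sq_eq_re_trace, hD0.1.eq]
  have hdiff : (Matrix.trace D).re - (Matrix.trace (D * D)).re = (Matrix.trace (D * (1 - D))).re := by
    rw [mul_sub, mul_one, Matrix.trace_sub, Complex.sub_re]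
  have hpos : 0 ≤ (Matrix.trace (D * (1 - D))).re := re_trace_mul_nonneg_of_posSemidef hD0 hD1
  linarith


/-! ### Appendix (LEAD g24, for the linearised decoupling): the far part is also an operator-norm contraction -/

/-- **Unitary + low rank + small, with the operator-norm bound on the small part.**  If `1 − MM† = D₁ + D₂` then
`M = Θ + R + S` with `Θ` unitary, `rank R ≤ rank D₁`, `Σ|S_{ij}|² ≤ Σ|(D₂)_{ij}|²` AND `‖S‖_op ≤ ‖D₂‖_op` (`S = −D₂X`, `‖X‖_op ≤ 1`).
In the use `0 ≤ D₂ ≤ 1`, so `‖S‖_op ≤ 1` and products `S₁V₁S₂V₂` are bounded LINEARLY: `‖S₁V₁S₂V₂‖_F ≤ ‖S₁‖_F`. -/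
theorem exists_unitary_add_lowRank_add_small_opNorm (M D₁ D₂ : Matrix n n ℂ) (hD : 1 - M * Mᴴ = D₁ + D₂) :
    ∃ Θ R S : Matrix n n ℂ, Θ ∈ Matrix.unitaryGroup n ℂ ∧ R.rank ≤ D₁.rank ∧
      ∑ i, ∑ j, ‖S i j‖ ^ 2 ≤ ∑ i, ∑ j, ‖D₂ i j‖ ^ 2 ∧ ‖S‖ ≤ ‖D₂‖ ∧ M = Θ + R + S := by
  obtain ⟨Θ, hΘ, X, hX, hMX⟩ := exists_polar_defect_general M
  refine ⟨Θ, -(D₁ * X), -(D₂ * X), hΘ, ?_, ?_, ?_, ?_⟩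
  · rw [rank_neg]; exact Matrix.rank_mul_le_left _ _
  · have h := sum_norm_sq_mul_le' X D₂
    have hX1 : ‖X‖ ^ 2 ≤ 1 := by
      have := norm_nonneg X
      nlinarith
    have h0 : 0 ≤ ∑ i, ∑ j, ‖D₂ i j‖ ^ 2 := Finset.sum_nonneg fun _ _ => Finset.sum_nonneg fun _ _ => by positivity
    calc ∑ i, ∑ j, ‖(-(D₂ * X)) i j‖ ^ 2 = ∑ i, ∑ j, ‖(D₂ * X) i j‖ ^ 2 := by simp
      _ ≤ ‖X‖ ^ 2 * ∑ i, ∑ j, ‖D₂ i j‖ ^ 2 := h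
      _ ≤ 1 * ∑ i, ∑ j, ‖D₂ i j‖ ^ 2 := by gcongr
      _ = ∑ i, ∑ j, ‖D₂ i j‖ ^ 2 := one_mul _
  · letI : CStarAlgebra (Matrix n n ℂ) := {}
    rw [norm_neg]
    calc ‖D₂ * X‖ ≤ ‖D₂‖ * ‖X‖ := norm_mul_le _ _
      _ ≤ ‖D₂‖ * 1 := by gcongr
      _ = ‖D₂‖ := mul_one _
  · calc M = Θ + (M - Θ) := by abel
      _ = Θ + -(D₁ * X) + -(D₂ * X) := by rw [hMX, hD]; noncomm_ring

/-- `0 ≤ D ≤ 1 ⇒ ‖D‖_op ≤ 1` (C⋆-order). -/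
theorem opNorm_le_one_of_posSemidef_le_one {D : Matrix n n ℂ} (hD0 : D.PosSemidef) (hD1 : (1 - D).PosSemidef) : ‖D‖ ≤ 1 := by
  letI : CStarAlgebra (Matrix n n ℂ) := {}
  have h0 : (0 : Matrix n n ℂ) ≤ D := hD0.nonneg
  have h1 : D ≤ 1 := by rw [Matrix.le_iff]; exact hD1
  exact (CStarAlgebra.norm_le_one_iff_of_nonneg D h0).mpr h1

end Summit.QuantumFields.YangMills.Theorems.EguchiKawaiDirectionLadder

end
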